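/-
Copyright (c) 2026 the pub-hodgecm-mathlib formalisation cell (harness21).  Prover seat hodgecm-mathlib-R90-C10-p01 (g2), SLAB R90-TF, section S1 «Ch. 10∕12 local», lent to
the cell «U4-RAM» (L4 line-lead K2E3-plan (g5)); crux H413 = `stmt-HodgeConjecture-24833`; socket of record S1 A2′ = K2E3 leaf (U4f-χ₁-ram-one) ⊇ U4Keys :155 (depth 0,
Branch B) AT A RAMIFIED PLACE — the RAMIFIED d0B chain of R90-C10-p05 (g0) (★ `R90S1BranchBFromDetRamified` and its ★ inputs).  2026-09-04.
KERNEL module: THEOREMS ONLY (no definition, no named fact, no `sorry`, no instance, no notation).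
-/
import Summits.HodgeConjecture.HodgeConjecture.Theorems.K2E3BranchBShellScalingFromWeightSeries   -- ★ p862287 (K2E3-p06 (g5)) (II)-a at inert `v`: region dictionary `setOf_one_le_v_eq`, `height_eq_coe_normAbs`, `normAbs_eq_iff_valued_eq`; brings ★ B6 `K2E3WeightShellSeries` (uniformiser-generic shell series) and ★ B5
import HarnessLib

/-!
# R90 · S1 ∕ U4Keys leaf (U4f-χ₁-ram-one-d0B) — the SCALING IDENTITY of the Casselman integrand for an ARBITRARY uniformiser unit `Π`:
# `∫_{S_ge} F₀ = ∫_{Sh0} F₀ + ∫_{Sh1} F₀ + X·∫_{S_ge} F₀`, `X = χ₁(σΠ·Π)` — letter `hscal` of the RAMIFIED depth-zero Branch-B chain   [Casselman1995 §6.4; Keys1984 §3–§4, §7 Thm (2) (d)]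

Cell `hodgecm-mathlib`, SLAB R90-TF, section S1, crux H413 = `stmt-HodgeConjecture-24833` (lane `--supports … --as helper`), route of record `HCCMUnconditional` (no route verbs);
prover seat `hodgecm-mathlib-R90-C10-p01` (g2), lent to «U4-RAM» (dealer K2E3-plan (g5)); ramified d0B chain of R90-C10-p05 (g0) (PAPER-Z3-DepthZeroRamified §1, ★
`R90S1BranchBFromDetRamified.exists_eta_of_det_eq_zero_of_bigCellEntries_ram`).  THEOREMS ONLY; ★-only imports.  NOT THE PAYER of :155.

THE POINT.  ★ (II)-a `K2E3BranchBShellScalingFromWeightSeries.integral_S_ge_eq` states the torus-dilation identity of the frame-v1 integrand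
`F₀(n) = χ₁(σ n̂₀₂)⁻¹ · ‖n̂₀₂‖⁻¹` at an INERT place, dilating by the `σ`-fixed uniformiser unit `ϖ̂ = ι_v ϖ_v` (ratio `Y² = χ₁(ϖ̂)²`, hypothesis `hunr`).  At a RAMIFIED place `ϖ̂`
is not a uniformiser of `L_w` (`|ϖ̂_w| = exp(−2)`), but the underlying ★ B6 shell series `K2E3WeightShellSeries.weightIntegral_near_eq` (`G₂ = T₀ + G₁`) and
`…weightIntegral_far_mul_one_sub_eq` (`G₁(1−ρ) = T₁ + ρT₀`, `ρ = χ₁(Π·σΠ)`) are stated for ANY uniformiser unit `Π` of `L ⊗ L⁺_v` (`|Π_w′| = exp(−1)` at every `w′ ∣ v`).  This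
file reads them off for such a `Π` — R90-C10-p05's letter `piU`, `hpiU` of ★ `…FromDetRamified` — with the ratio in HIS spelling `X := χ₁(σΠ·Π)`:
* §1 the two shells in height currency for a general unit: **`setOf_v_eq_one_eq_pow_zero_of_unit`** `{|z_w| = 1} = {m = (‖Π‖⁻¹)^0}`, **`setOf_v_eq_exp_one_eq_of_uniformizer`**
  `{|z_w| = exp 1} = {m = (‖Π‖⁻¹)^1}` (`m(n) = ‖(n₀₂)_w‖` ★ `height_eq_coe_normAbs`, `‖Π‖ = ‖Π_w‖` ★ `unitModulusChar_localRing_eq_prod` + ★ DICT, `|Π_w| = exp(−1)`).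
* §2 **`integral_S_ge_eq_of_uniformizer`** — for `v` non-split (ANY ramification), `μ` Haar on `N(L⁺_v)`, `χ₁` any homomorphism with `‖X‖ < 1`, and `F₀` integrable on
  `S_ge = {1 ≤ |z_w|}`: **`∫_{S_ge} F₀ = ∫_{|z_w| = 1} F₀ + ∫_{|z_w| = exp 1} F₀ + X · ∫_{S_ge} F₀`**, `X = χ₁(σΠ·Π)` — `G₂ = T₀ + G₁` and `G₁(1−ρ) = T₁ + ρT₀` give
  `G₂ = T₀ + T₁ + ρG₂`, and `ρ = χ₁(Π·σΠ) = X` (`mul_comm`).  At an inert place with `Π := ϖ̂` this is ★ p862287 §2 (`X = Y²`); at a tame ramified place it is the letter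
  `hscal` of the coming wrapper `exists_eta_of_reducible_of_shells_ram` (R90-C10-p05): with the odd shell `∫_{Sh1} F₀ = 0` and the even shell `∫_{Sh0} F₀ = c₀·((q−1)∕q)·V`
  (separate files) it yields `∫_{S_ge} F₀ = c₀·((q−1)∕q)·V∕(1−X)` and `∫_{S_gt} F₀ = c₀·((q−1)∕q)·V·X∕(1−X)` — the big-cell entries `hwwv`, `h11v` of ★ `…FromDetRamified`
  (PAPER-Z3-DepthZeroRamified §1: `G₂ = Σ_{k≥0} c₀(q−1)q⁻¹X^k`, `G₁ = Σ_{k≥1}`).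
The integrability letter `hint` is ★ p862287 §3 `integrableOn_F₀_S_ge` (place-generic: `hns`, `χ₁` continuous and contracting) — nothing to type at a ramified place.
HONEST LABEL: HC_CM is proved only modulo the 7 printed citations (2 remaining named inputs: hLiu418 = `stmt-HodgeConjecture-24832`, h413 = `stmt-HodgeConjecture-24833`)
until rung 0 closes; count-neutral — this file does NOT pay :155; no printed citation is discharged.

## References
* [Casselman1995] W. Casselman, *Introduction to the theory of admissible representations of `p`-adic reductive groups* (1995), §6.4 p. 63 (shell-by-shell evaluation).
* [Keys1984] D. Keys, *Principal series representations of special unitary groups over local fields*, Compositio Math. 51 (1984), §3–§4, §7 Thm (2) (d) p. 126.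
* [TateThesis1967] J. Tate, *Fourier analysis in number fields and Hecke's zeta-functions*, in Cassels–Fröhlich (1967), §2.4.
* [WeilBNT1967] A. Weil, *Basic Number Theory* (1967), Ch. I §4, Ch. II §5 Prop. 12.
-/

set_option autoImplicit false
-- the mandated namespace has the single-problem summit's repeated segment (`HodgeConjecture.HodgeConjecture`)
set_option linter.dupNamespace false

noncomputable section

open NumberField IsDedekindDomain MeasureTheory
open scoped Matrix MatrixGroups WithZero Valued NNReal ENNReal
open Literature.NumberTheory Literature.NumberTheory.Automorphic Literature.NumberTheory.Automorphic.UnitaryGroup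
open Literature.NumberTheory.Rogawski1990 Literature.NumberTheory.GaloisRepresentations Literature.NumberTheory.GaloisRepresentations.IsNonarchimedeanLocalField

namespace Summit.HodgeConjecture.HodgeConjecture.R90.S1

open Summit.HodgeConjecture.HodgeConjecture.Cruxes.H413
open Summit.HodgeConjecture.HodgeConjecture.Cruxes.H413.K2E3BranchBShellScalingFromWeightSeries

open Classical

variable (L : Type) [Field L] [NumberField L] [IsCMField L] (v : HeightOneSpectrum (𝓞 ↥(maximalRealSubfield L)))
  (w : PlacesOver L v) (hw : IsCMField.complexConj L • w.1 = w.1)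

/-! ## §1 The two shells in height currency, for an arbitrary unit ∕ uniformiser unit `Π` -/

include hw in
set_option maxHeartbeats 6000000 in
set_option synthInstance.maxHeartbeats 400000 in
-- the coercion chain `((n : ↥U) : GL) : Matrix) 0 2` in the statement needs ★ B6's budget (scoped)
/-- **`{n | |(n₀₂)_w|_w = 1} = {n | m(n) = (‖Π‖⁻¹)^0}`** for ANY unit `Π` of `L ⊗ L⁺_v` (★ B6's shell `S_0` for `ϖ := Π`; the exponent-zero power is `1`): `m(n) = ‖(n₀₂)_w‖` (★
`height_eq_coe_normAbs`) and `‖x‖ = ‖1‖ ↔ |x|_w = 1` (★ `normAbs_eq_iff_valued_eq`). [cite: Casselman1995, §6.4 p. 63] [cite: WeilBNT1967, Ch. I §4] -/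
theorem setOf_v_eq_one_eq_pow_zero_of_unit (piU : (LocalRing L v)ˣ) :
    {m : ↥(cmBorelTriple L 3 v).N | Valued.v (((((m : ↥(unitaryGroupOfForm (conjLocal L (IsCMField.complexConj L) v) (cmLocalForm L 3 v))) : GL (Fin 3) (LocalRing L v)) : Matrix (Fin 3) (Fin 3) (LocalRing L v)) 0 2) w) = 1} =
      {u : ↥(cmBorelTriple L 3 v).N | (((∏ w' : PlacesOver L v, normAbs (w'.1.adicCompletion L) ((((((u : ↥(unitaryGroupOfForm (conjLocal L (IsCMField.complexConj L) v) (cmLocalForm L 3 v)))) : GL (Fin 3) (LocalRing L v)) : Matrix (Fin 3) (Fin 3) (LocalRing L v)) 0 2) w')) : ℝ≥0) : ℝ) = (((unitModulusChar (LocalRing L v) piU : ℝ≥0) : ℝ)⁻¹) ^ 0} := by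
  ext m
  simp only [Set.mem_setOf_eq]
  rw [pow_zero, height_eq_coe_normAbs L v w hw, ← NNReal.coe_one, NNReal.coe_inj, ← map_one (normAbs (w.1.adicCompletion L)),
    normAbs_eq_iff_valued_eq L v w, map_one]

include hw in
set_option maxHeartbeats 6000000 in
set_option synthInstance.maxHeartbeats 400000 in
-- the coercion chain `((n : ↥U) : GL) : Matrix) 0 2` in the statement needs ★ B6's budget (scoped)
/-- **`{n | |(n₀₂)_w|_w = exp 1} = {n | m(n) = (‖Π‖⁻¹)^1}`** for a unit `Π` of `L ⊗ L⁺_v` with `|Π_w| = exp(−1)` (★ B6's shell `S_1` for `ϖ := Π`; ANY ramification of `w ∣ v`):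
`‖Π‖ = ‖Π_w‖` (★ `unitModulusChar_localRing_eq_prod` + ★ DICT `prod_normAbs_eq_normAbs_apply`), so `m(n) = ‖Π_w‖⁻¹ = ‖Π_w⁻¹‖ ↔ |(n₀₂)_w| = |Π_w|⁻¹ = exp 1`.
[cite: Casselman1995, §6.4 p. 63] [cite: WeilBNT1967, Ch. I §4] -/
theorem setOf_v_eq_exp_one_eq_of_uniformizer (piU : (LocalRing L v)ˣ) (hpiUw : Valued.v ((piU : LocalRing L v) w) = WithZero.exp (-1 : ℤ)) :
    {m : ↥(cmBorelTriple L 3 v).N | Valued.v (((((m : ↥(unitaryGroupOfForm (conjLocal L (IsCMField.complexConj L) v) (cmLocalForm L 3 v))) : GL (Fin 3) (LocalRing L v)) : Matrix (Fin 3) (Fin 3) (LocalRing L v)) 0 2) w) = WithZero.exp (1 : ℤ)} =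
      {u : ↥(cmBorelTriple L 3 v).N | (((∏ w' : PlacesOver L v, normAbs (w'.1.adicCompletion L) ((((((u : ↥(unitaryGroupOfForm (conjLocal L (IsCMField.complexConj L) v) (cmLocalForm L 3 v)))) : GL (Fin 3) (LocalRing L v)) : Matrix (Fin 3) (Fin 3) (LocalRing L v)) 0 2) w')) : ℝ≥0) : ℝ) = (((unitModulusChar (LocalRing L v) piU : ℝ≥0) : ℝ)⁻¹) ^ 1} := by
  have ha : ((unitModulusChar (LocalRing L v) piU : ℝ≥0) : ℝ) = ((normAbs (w.1.adicCompletion L) ((piU : LocalRing L v) w) : ℝ≥0) : ℝ) := by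
    rw [unitModulusChar_localRing_eq_prod, F0P3cStCharTSLocalRingNormDictionary.prod_normAbs_eq_normAbs_apply L v w hw]
  ext m
  simp only [Set.mem_setOf_eq]
  rw [pow_one, height_eq_coe_normAbs L v w hw, ha, ← NNReal.coe_inv, NNReal.coe_inj, ← map_inv₀, normAbs_eq_iff_valued_eq L v w, map_inv₀, hpiUw,
    ← WithZero.exp_neg, neg_neg]

/-! ## §2 Letter `hscal` for an arbitrary uniformiser unit: `∫_{S_ge} F₀ = ∫_{Sh0} F₀ + ∫_{Sh1} F₀ + X · ∫_{S_ge} F₀`, `X = χ₁(σΠ·Π)` -/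

include hw in
set_option maxHeartbeats 6000000 in
set_option synthInstance.maxHeartbeats 400000 in
-- the statement carries the coercion chain `((n : ↥U) : GL) : Matrix) 0 2` eleven times and ★ B6's shell sets: the budget of ★ p862287 ∕ ★ B6, scoped to this theorem
/-- **THE SCALING IDENTITY FOR AN ARBITRARY UNIFORMISER UNIT (letter `hscal` of the ramified d0B chain).**  `v` non-split (ANY ramification), `w ∣ v`, `Π` a unit of
`L ⊗ L⁺_v` with `|Π_w′| = exp(−1)` at every `w′ ∣ v` (R90-C10-p05's `piU`, `hpiU`), `μ` a Haar measure on `N(L⁺_v)`, `χ₁ : (L ⊗ L⁺_v)ˣ → ℂˣ` ANY homomorphism with `‖X‖ < 1`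
for `X = χ₁(σΠ·Π)`, and the frame-v1 integrand `F₀(n) = χ₁(σ n̂₀₂)⁻¹ · ‖n̂₀₂‖⁻¹` (`n₀₂` a unit; else `0`) integrable on `S_ge = {1 ≤ |(n₀₂)_w|}`.  Then
**`∫_{S_ge} F₀ = ∫_{|(n₀₂)_w| = 1} F₀ + ∫_{|(n₀₂)_w| = exp 1} F₀ + X · ∫_{S_ge} F₀`.**  PROOF: ★ B6 with the weight letter `c := F₀` (`χ₂ = 1`) and `ϖ := Π`: `G₂ = T₀ + G₁`
(`weightIntegral_near_eq`) and `G₁·(1 − ρ) = T₁ + ρ·T₀` (`weightIntegral_far_mul_one_sub_eq`) with `ρ = χ₁(Π·σΠ) = X` (`mul_comm`), whence `G₂ = T₀ + T₁ + X·G₂`; the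
regions are translated by ★ `setOf_one_le_v_eq` and §1.  At an inert place with `Π := ϖ̂` this is ★ `integral_S_ge_eq` (`X = Y²`); at a tame ramified place, with the
odd shell `= 0` and the even shell `= c₀·((q−1)∕q)·V`, it gives `Λ_{w₀} f_w = c₀·((q−1)∕q)·V∕(1−X)` and `Λ_1 f₁ = c₀·((q−1)∕q)·V·X∕(1−X)` (PAPER-Z3-DepthZeroRamified §1).
[cite: Casselman1995, §6.4 p. 63] [cite: Keys1984, §3–§4, §7 Theorem (2) (d) p. 126] [cite: TateThesis1967, §2.4] -/
theorem integral_S_ge_eq_of_uniformizer (hns : ∀ w' : PlacesOver L v, IsCMField.complexConj L • w'.1 = w'.1)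
    (piU : (LocalRing L v)ˣ) (hpiU : ∀ w' : PlacesOver L v, Valued.v ((piU : LocalRing L v) w') = WithZero.exp (-1 : ℤ))
    (χ₁ : (LocalRing L v)ˣ →* ℂˣ)
    [MeasurableSpace ↥(cmBorelTriple L 3 v).N] [BorelSpace ↥(cmBorelTriple L 3 v).N] (μ : Measure ↥(cmBorelTriple L 3 v).N) [μ.IsHaarMeasure]
    (hX : ‖((χ₁ (Units.map (conjLocal L (IsCMField.complexConj L) v : LocalRing L v →* LocalRing L v) piU * piU) : ℂˣ) : ℂ)‖ < 1)
    (hint : IntegrableOn (fun n : ↥(cmBorelTriple L 3 v).N =>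
        if h : IsUnit ((((n : ↥(unitaryGroupOfForm (conjLocal L (IsCMField.complexConj L) v) (cmLocalForm L 3 v))) : GL (Fin 3) (LocalRing L v)) : Matrix (Fin 3) (Fin 3) (LocalRing L v)) 0 2) then
          ((((χ₁ (Units.map ((conjLocal L (IsCMField.complexConj L) v) : LocalRing L v →* LocalRing L v) h.unit))⁻¹ : ℂˣ) : ℂ) *
            ((((unitModulusChar (LocalRing L v) h.unit)⁻¹ : ℝ≥0) : ℝ) : ℂ))
        else 0) {m : ↥(cmBorelTriple L 3 v).N | 1 ≤ Valued.v (((((m : ↥(unitaryGroupOfForm (conjLocal L (IsCMField.complexConj L) v) (cmLocalForm L 3 v))) : GL (Fin 3) (LocalRing L v)) : Matrix (Fin 3) (Fin 3) (LocalRing L v)) 0 2) w)} μ) :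
    ∫ n in {m : ↥(cmBorelTriple L 3 v).N | 1 ≤ Valued.v (((((m : ↥(unitaryGroupOfForm (conjLocal L (IsCMField.complexConj L) v) (cmLocalForm L 3 v))) : GL (Fin 3) (LocalRing L v)) : Matrix (Fin 3) (Fin 3) (LocalRing L v)) 0 2) w)}, (fun n : ↥(cmBorelTriple L 3 v).N =>
        if h : IsUnit ((((n : ↥(unitaryGroupOfForm (conjLocal L (IsCMField.complexConj L) v) (cmLocalForm L 3 v))) : GL (Fin 3) (LocalRing L v)) : Matrix (Fin 3) (Fin 3) (LocalRing L v)) 0 2) then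
          ((((χ₁ (Units.map ((conjLocal L (IsCMField.complexConj L) v) : LocalRing L v →* LocalRing L v) h.unit))⁻¹ : ℂˣ) : ℂ) *
            ((((unitModulusChar (LocalRing L v) h.unit)⁻¹ : ℝ≥0) : ℝ) : ℂ))
        else 0) n ∂μ =
      (∫ n in {m : ↥(cmBorelTriple L 3 v).N | Valued.v (((((m : ↥(unitaryGroupOfForm (conjLocal L (IsCMField.complexConj L) v) (cmLocalForm L 3 v))) : GL (Fin 3) (LocalRing L v)) : Matrix (Fin 3) (Fin 3) (LocalRing L v)) 0 2) w) = 1}, (fun n : ↥(cmBorelTriple L 3 v).N =>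
        if h : IsUnit ((((n : ↥(unitaryGroupOfForm (conjLocal L (IsCMField.complexConj L) v) (cmLocalForm L 3 v))) : GL (Fin 3) (LocalRing L v)) : Matrix (Fin 3) (Fin 3) (LocalRing L v)) 0 2) then
          ((((χ₁ (Units.map ((conjLocal L (IsCMField.complexConj L) v) : LocalRing L v →* LocalRing L v) h.unit))⁻¹ : ℂˣ) : ℂ) *
            ((((unitModulusChar (LocalRing L v) h.unit)⁻¹ : ℝ≥0) : ℝ) : ℂ))
        else 0) n ∂μ) + (∫ n in {m : ↥(cmBorelTriple L 3 v).N | Valued.v (((((m : ↥(unitaryGroupOfForm (conjLocal L (IsCMField.complexConj L) v) (cmLocalForm L 3 v))) : GL (Fin 3) (LocalRing L v)) : Matrix (Fin 3) (Fin 3) (LocalRing L v)) 0 2) w) = WithZero.exp (1 : ℤ)}, (fun n : ↥(cmBorelTriple L 3 v).N =>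
        if h : IsUnit ((((n : ↥(unitaryGroupOfForm (conjLocal L (IsCMField.complexConj L) v) (cmLocalForm L 3 v))) : GL (Fin 3) (LocalRing L v)) : Matrix (Fin 3) (Fin 3) (LocalRing L v)) 0 2) then
          ((((χ₁ (Units.map ((conjLocal L (IsCMField.complexConj L) v) : LocalRing L v →* LocalRing L v) h.unit))⁻¹ : ℂˣ) : ℂ) *
            ((((unitModulusChar (LocalRing L v) h.unit)⁻¹ : ℝ≥0) : ℝ) : ℂ))
        else 0) n ∂μ) +
        ((χ₁ (Units.map (conjLocal L (IsCMField.complexConj L) v : LocalRing L v →* LocalRing L v) piU * piU) : ℂˣ) : ℂ) * ∫ n in {m : ↥(cmBorelTriple L 3 v).N | 1 ≤ Valued.v (((((m : ↥(unitaryGroupOfForm (conjLocal L (IsCMField.complexConj L) v) (cmLocalForm L 3 v))) : GL (Fin 3) (LocalRing L v)) : Matrix (Fin 3) (Fin 3) (LocalRing L v)) 0 2) w)}, (fun n : ↥(cmBorelTriple L 3 v).N =>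
        if h : IsUnit ((((n : ↥(unitaryGroupOfForm (conjLocal L (IsCMField.complexConj L) v) (cmLocalForm L 3 v))) : GL (Fin 3) (LocalRing L v)) : Matrix (Fin 3) (Fin 3) (LocalRing L v)) 0 2) then
          ((((χ₁ (Units.map ((conjLocal L (IsCMField.complexConj L) v) : LocalRing L v →* LocalRing L v) h.unit))⁻¹ : ℂˣ) : ℂ) *
            ((((unitModulusChar (LocalRing L v) h.unit)⁻¹ : ℝ≥0) : ℝ) : ℂ))
        else 0) n ∂μ := by
  -- `ρ = χ₁(Π·σΠ) = χ₁(σΠ·Π) = X`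
  have hρ : ((χ₁ (piU * Units.map (conjLocal L (IsCMField.complexConj L) v : LocalRing L v →* LocalRing L v) piU) : ℂˣ) : ℂ) = ((χ₁ (Units.map (conjLocal L (IsCMField.complexConj L) v : LocalRing L v →* LocalRing L v) piU * piU) : ℂˣ) : ℂ) := by
    rw [mul_comm piU]
  have hρ1 : ‖((χ₁ (piU * Units.map (conjLocal L (IsCMField.complexConj L) v : LocalRing L v →* LocalRing L v) piU) : ℂˣ) : ℂ)‖ < 1 := by
    rw [hρ]; exact hX
  -- the weight letter: `F₀` is ★ B6's weight for `(χ₁, χ₂) = (χ₁, 1)`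
  have hc : ∀ u : ↥(cmBorelTriple L 3 v).N, (fun n : ↥(cmBorelTriple L 3 v).N =>
        if h : IsUnit ((((n : ↥(unitaryGroupOfForm (conjLocal L (IsCMField.complexConj L) v) (cmLocalForm L 3 v))) : GL (Fin 3) (LocalRing L v)) : Matrix (Fin 3) (Fin 3) (LocalRing L v)) 0 2) then
          ((((χ₁ (Units.map ((conjLocal L (IsCMField.complexConj L) v) : LocalRing L v →* LocalRing L v) h.unit))⁻¹ : ℂˣ) : ℂ) *
            ((((unitModulusChar (LocalRing L v) h.unit)⁻¹ : ℝ≥0) : ℝ) : ℂ))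
        else 0) u =
      (if hb : IsUnit (((((u : ↥(unitaryGroupOfForm (conjLocal L (IsCMField.complexConj L) v) (cmLocalForm L 3 v)))) : GL (Fin 3) (LocalRing L v)) : Matrix (Fin 3) (Fin 3) (LocalRing L v)) 0 2) then
          ((((χ₁ (Units.map (conjLocal L (IsCMField.complexConj L) v : LocalRing L v →* LocalRing L v) hb.unit))⁻¹ : ℂˣ) : ℂ) *
            (((1 : ↥(normOneUnits (conjLocal L (IsCMField.complexConj L) v)) →* ℂˣ) ⟨-1, F0P3cStCharTSBigCellFactorisation.neg_one_mem_normOneUnits (conjLocal L (IsCMField.complexConj L) v)⟩ : ℂˣ) : ℂ) *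
            ((((unitModulusChar (LocalRing L v) hb.unit)⁻¹ : ℝ≥0) : ℝ) : ℂ))
        else 0) := by
    intro u
    show (if h : IsUnit ((((u : ↥(unitaryGroupOfForm (conjLocal L (IsCMField.complexConj L) v) (cmLocalForm L 3 v))) : GL (Fin 3) (LocalRing L v)) : Matrix (Fin 3) (Fin 3) (LocalRing L v)) 0 2) then
          ((((χ₁ (Units.map ((conjLocal L (IsCMField.complexConj L) v) : LocalRing L v →* LocalRing L v) h.unit))⁻¹ : ℂˣ) : ℂ) *
            ((((unitModulusChar (LocalRing L v) h.unit)⁻¹ : ℝ≥0) : ℝ) : ℂ))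
        else 0) = _
    by_cases hb : IsUnit ((((u : ↥(unitaryGroupOfForm (conjLocal L (IsCMField.complexConj L) v) (cmLocalForm L 3 v))) : GL (Fin 3) (LocalRing L v)) : Matrix (Fin 3) (Fin 3) (LocalRing L v)) 0 2)
    · rw [dif_pos hb, dif_pos hb, MonoidHom.one_apply, Units.val_one, mul_one]
    · rw [dif_neg hb, dif_neg hb]
  -- regions in height currency
  have hsub : {u : ↥(cmBorelTriple L 3 v).N | 1 < (((∏ w' : PlacesOver L v, normAbs (w'.1.adicCompletion L) ((((((u : ↥(unitaryGroupOfForm (conjLocal L (IsCMField.complexConj L) v) (cmLocalForm L 3 v)))) : GL (Fin 3) (LocalRing L v)) : Matrix (Fin 3) (Fin 3) (LocalRing L v)) 0 2) w')) : ℝ≥0) : ℝ)} ⊆ {u : ↥(cmBorelTriple L 3 v).N | 1 ≤ (((∏ w' : PlacesOver L v, normAbs (w'.1.adicCompletion L) ((((((u : ↥(unitaryGroupOfForm (conjLocal L (IsCMField.complexConj L) v) (cmLocalForm L 3 v)))) : GL (Fin 3) (LocalRing L v)) : Matrix (Fin 3) (Fin 3) (LocalRing L v)) 0 2) w')) : ℝ≥0)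 : ℝ)} :=
    fun u hu => by rw [Set.mem_setOf_eq] at hu ⊢; exact le_of_lt hu
  have hint' : IntegrableOn (fun n : ↥(cmBorelTriple L 3 v).N =>
        if h : IsUnit ((((n : ↥(unitaryGroupOfForm (conjLocal L (IsCMField.complexConj L) v) (cmLocalForm L 3 v))) : GL (Fin 3) (LocalRing L v)) : Matrix (Fin 3) (Fin 3) (LocalRing L v)) 0 2) then
          ((((χ₁ (Units.map ((conjLocal L (IsCMField.complexConj L) v) : LocalRing L v →* LocalRing L v) h.unit))⁻¹ : ℂˣ) : ℂ) *
            ((((unitModulusChar (LocalRing L v) h.unit)⁻¹ : ℝ≥0) : ℝ) : ℂ))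
        else 0) {u : ↥(cmBorelTriple L 3 v).N | 1 ≤ (((∏ w' : PlacesOver L v, normAbs (w'.1.adicCompletion L) ((((((u : ↥(unitaryGroupOfForm (conjLocal L (IsCMField.complexConj L) v) (cmLocalForm L 3 v)))) : GL (Fin 3) (LocalRing L v)) : Matrix (Fin 3) (Fin 3) (LocalRing L v)) 0 2) w')) : ℝ≥0) : ℝ)} μ := by
    rw [← setOf_one_le_v_eq L v w hw]; exact hint
  have hnear := K2E3WeightShellSeries.weightIntegral_near_eq L v hns piU hpiU μ
    (fun n : ↥(cmBorelTriple L 3 v).N =>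
        if h : IsUnit ((((n : ↥(unitaryGroupOfForm (conjLocal L (IsCMField.complexConj L) v) (cmLocalForm L 3 v))) : GL (Fin 3) (LocalRing L v)) : Matrix (Fin 3) (Fin 3) (LocalRing L v)) 0 2) then
          ((((χ₁ (Units.map ((conjLocal L (IsCMField.complexConj L) v) : LocalRing L v →* LocalRing L v) h.unit))⁻¹ : ℂˣ) : ℂ) *
            ((((unitModulusChar (LocalRing L v) h.unit)⁻¹ : ℝ≥0) : ℝ) : ℂ))
        else 0) hint'
  have hfar := K2E3WeightShellSeries.weightIntegral_far_mul_one_sub_eq L v hns χ₁ 1 piU hpiU μ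
    (fun n : ↥(cmBorelTriple L 3 v).N =>
        if h : IsUnit ((((n : ↥(unitaryGroupOfForm (conjLocal L (IsCMField.complexConj L) v) (cmLocalForm L 3 v))) : GL (Fin 3) (LocalRing L v)) : Matrix (Fin 3) (Fin 3) (LocalRing L v)) 0 2) then
          ((((χ₁ (Units.map ((conjLocal L (IsCMField.complexConj L) v) : LocalRing L v →* LocalRing L v) h.unit))⁻¹ : ℂˣ) : ℂ) *
            ((((unitModulusChar (LocalRing L v) h.unit)⁻¹ : ℝ≥0) : ℝ) : ℂ))
        else 0) hc hρ1 (hint'.mono_set hsub)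
  rw [hρ] at hfar
  rw [setOf_one_le_v_eq L v w hw, setOf_v_eq_one_eq_pow_zero_of_unit L v w hw piU, setOf_v_eq_exp_one_eq_of_uniformizer L v w hw piU (hpiU w)]
  linear_combination (1 - ((χ₁ (Units.map (conjLocal L (IsCMField.complexConj L) v : LocalRing L v →* LocalRing L v) piU * piU) : ℂˣ) : ℂ)) * hnear + hfar

end Summit.HodgeConjecture.HodgeConjecture.R90.S1

end
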